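import Summits.RiemannHypothesis.RiemannHypothesis.Theorems.GroundBartaEvenWinsBeyondArchDeflationOutsideImagePrelim
import HarnessLib

/-!
# RiemannHypothesis / GroundBarta — rung 4 (`EvenWinsBeyondArch`, stmt-RiemannHypothesis-18807 / 18085):
# the window image of an edge-vanishing trial vector OUTSIDE its support (the sliver `c' < |y| ≤ c`)

Helper file (`--supports stmt-RiemannHypothesis-18085`), RH-free, Mathlib + landed tree files only, no definitions,
no named facts.  Prover A (g10 of unit `sr-gb-rung-a`), endpoint cell `(log 5)/2`.

At the endpoint the trial vectors `v = g·𝟙_{[-c',c']}` (`g ∈ C¹`, `g(±c') = 0`, `|g| ≤ G₀`, `|g'| ≤ L` on the support)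
are cut at a rational `c'` below the window `c`, so the window-`c` residual has an OUTSIDE part: on the sliver
`c' < |y| ≤ c` the image is the bare value
`T(y) = 2(∫v ch)ch(y/2) − 2(∫v sh)sh(y/2) + Σ_{n∈I} Λ(n)n^{-1/2}(2v(y) − v(y−log n) − v(y+log n)) + ∫₀^∞ ρ(t)(2v(y) − v(y−t) − v(y+t))dt`
(no killing term, `v = 0` there).  This file bounds `T` on the sliver ANALYTICALLY from `‖T(c')‖` (a certified number)
and the Lipschitz data of `v`: for `c' < y ≤ 1`, `d = y − c'`,

  `‖T(y) − T(c')‖ ≤ d·(12G₀ + Λ_I L + L(1 + C₁)) + d·(3/4)L·(−log d)`,  `C₁ = ∫_{[1,∞)} ρ`, `Λ_I = Σ_{n∈I} Λ(n)n^{-1/2}`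

(pole layer by the mean value theorem, prime layer by the Lipschitz bound, archimedean layer by
`∫₀^d ρ(t)·Lt + Ld·∫_d^∞ ρ` and the edge logarithm `∫_d^∞ ρ ≤ (3/4)log(1/d) + C₁`).  Since the sliver of the endpoint
cell has width `≈ 6·10⁻⁹`, this crude bound makes the outside residual Gram negligible without any panel quadrature.

* `dt_outsideImage_sub_le` — the displayed bound.
-/

set_option linter.dupNamespace false

noncomputable section

open MeasureTheory Set Filter
open scoped Topology ENNReal NNReal ComplexConjugate BigOperators

namespace Summit.RiemannHypothesis.RiemannHypothesis.Theorems.EvenWinsBeyondArch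

open Literature.NumberTheory.LFunctions
open Summit.RiemannHypothesis.RiemannHypothesis.Theorems.WeilParity.EvenWinsArch (mul_weilArchDensity_le)

/-- **The window image outside the support: variation from the edge.**  Let `v : ℝ → ℂ` be measurable, `‖v‖ ≤ G₀`,
`‖v(a) − v(b)‖ ≤ L|a − b|`, `v = 0` off `[-c', c']` (`0 < c'`), let `I` be a finite set of naturals and
`T(y) = 2(∫v ch)ch(y/2) − 2(∫v sh)sh(y/2) + Σ_{n∈I} Λ(n)n^{-1/2}(2v(y) − v(y − log n) − v(y + log n)) + ∫₀^∞ ρ(t)(2v(y) − v(y−t) − v(y+t)) dt`.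
Then for `c' < y ≤ 1`, with `d = y − c'` and `C₁ = ∫_{[1,∞)} ρ`,
`‖T(y) − T(c')‖ ≤ d·(12G₀ + (Σ_{n∈I}Λ(n)n^{-1/2})·L + L(1 + C₁)) + d·((3/4)L)·(−log d)`. [folklore] -/
theorem dt_outsideImage_sub_le {c' : ℝ} (hc' : 0 < c') {v : ℝ → ℂ} (hvm : Measurable v) {G₀ L : ℝ}
    (hG₀ : ∀ z, ‖v z‖ ≤ G₀) (hL : ∀ a b, ‖v a - v b‖ ≤ L * |a - b|) (hvs : ∀ z, z ∉ Icc (-c') c' → v z = 0)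
    (I : Finset ℕ) {T : ℝ → ℂ}
    (hT : ∀ y, T y = 2 * (∫ x, v x * (Real.cosh (x / 2) : ℂ)) * (Real.cosh (y / 2) : ℂ) -
        2 * (∫ x, v x * (Real.sinh (x / 2) : ℂ)) * (Real.sinh (y / 2) : ℂ) +
      (∑ n ∈ I, (((ArithmeticFunction.vonMangoldt n : ℝ) / Real.sqrt n : ℝ) : ℂ) *
        (2 * v y - v (y - Real.log n) - v (y + Real.log n))) +
      ∫ t in Ioi 0, (weilArchDensity t : ℂ) * (2 * v y - v (y - t) - v (y + t)))
    {y : ℝ} (hy : c' < y) (hy1 : y ≤ 1) :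
    ‖T y - T c'‖ ≤ (y - c') * (12 * G₀ + (∑ n ∈ I, (ArithmeticFunction.vonMangoldt n : ℝ) / Real.sqrt n) * L +
        L * (1 + ∫ t in Ici (1 : ℝ), weilArchDensity t)) + (y - c') * (3 / 4 * L) * (-Real.log (y - c')) := by
  have hG₀0 : 0 ≤ G₀ := (norm_nonneg _).trans (hG₀ 0)
  have hL0 : 0 ≤ L := by
    have h := hL 1 0; rw [sub_zero, abs_one, mul_one] at h; exact (norm_nonneg _).trans h
  have hc'1 : c' ≤ 1 := by linarith
  set d : ℝ := y - c' with hd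
  have hd0 : 0 < d := by rw [hd]; linarith
  have hd1 : d ≤ 1 := by rw [hd]; linarith
  set C₁ : ℝ := ∫ t in Ici (1 : ℝ), weilArchDensity t with hC₁
  have hC₁0 : 0 ≤ C₁ :=
    setIntegral_nonneg measurableSet_Ici fun t (ht : 1 ≤ t) ↦ (weilArchDensity_pos (by linarith)).le
  set Λs : ℝ := ∑ n ∈ I, (ArithmeticFunction.vonMangoldt n : ℝ) / Real.sqrt n with hΛs
  -- `v` vanishes at `c'` and beyond
  have hv_ge : ∀ z, c' ≤ z → v z = 0 := by
    intro z hz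
    rcases eq_or_lt_of_le hz with h | h
    · -- continuity at the edge: `‖v c'‖ = ‖v c' − v(c' + s)‖ ≤ L s` for every `s > 0`
      rw [← h]
      by_contra hne
      have hpos : 0 < ‖v c'‖ := norm_pos_iff.2 hne
      set s : ℝ := ‖v c'‖ / (2 * (L + 1)) with hs
      have hs0 : 0 < s := by positivity
      have hout : v (c' + s) = 0 := hvs _ (fun hm ↦ by have := hm.2; linarith)
      have h1 := hL c' (c' + s)
      rw [hout, sub_zero, show c' - (c' + s) = -s by ring, abs_neg, abs_of_pos hs0] at h1
      have hL1 : 0 < L + 1 := by linarith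
      have : L * s ≤ ‖v c'‖ / 2 := by
        calc L * s = (L / (L + 1)) * (‖v c'‖ / 2) := by rw [hs]; field_simp
          _ ≤ 1 * (‖v c'‖ / 2) := by
              refine mul_le_mul_of_nonneg_right ?_ (by positivity)
              rw [div_le_one hL1]; linarith
          _ = ‖v c'‖ / 2 := one_mul _
      linarith
    · exact hvs z (fun hm ↦ by have := hm.2; linarith)
  have hlog_nn : ∀ n : ℕ, 0 ≤ Real.log n := fun n ↦ Real.log_natCast_nonneg n
  -- the three layers at a point `z ≥ c'`
  set Pc : ℂ := ∫ x, v x * (Real.cosh (x / 2) : ℂ) with hPc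
  set Ps : ℂ := ∫ x, v x * (Real.sinh (x / 2) : ℂ) with hPs
  have hPcb : ‖Pc‖ ≤ 2 * c' * G₀ * Real.cosh (c' / 2) := (dt_norm_poleCoeff_le hc' hG₀ hvs).1
  have hPsb : ‖Ps‖ ≤ 2 * c' * G₀ * Real.cosh (c' / 2) := (dt_norm_poleCoeff_le hc' hG₀ hvs).2
  -- simplified form of `T` at points `z ≥ c'`
  have hTz : ∀ z, c' ≤ z → T z = 2 * Pc * (Real.cosh (z / 2) : ℂ) - 2 * Ps * (Real.sinh (z / 2) : ℂ) -
      (∑ n ∈ I, (((ArithmeticFunction.vonMangoldt n : ℝ) / Real.sqrt n : ℝ) : ℂ) * v (z - Real.log n)) -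
      ∫ t in Ioi 0, (weilArchDensity t : ℂ) * v (z - t) := by
    intro z hz
    rw [hT z]
    have h0 : v z = 0 := hv_ge z hz
    have hsum : (∑ n ∈ I, (((ArithmeticFunction.vonMangoldt n : ℝ) / Real.sqrt n : ℝ) : ℂ) *
        (2 * v z - v (z - Real.log n) - v (z + Real.log n))) =
        -(∑ n ∈ I, (((ArithmeticFunction.vonMangoldt n : ℝ) / Real.sqrt n : ℝ) : ℂ) * v (z - Real.log n)) := by
      rw [← Finset.sum_neg_distrib]
      refine Finset.sum_congr rfl fun n _ ↦ ?_
      rw [h0, hv_ge (z + Real.log n) (by linarith [hlog_nn n])]; ring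
    have harch : (∫ t in Ioi 0, (weilArchDensity t : ℂ) * (2 * v z - v (z - t) - v (z + t))) =
        -(∫ t in Ioi 0, (weilArchDensity t : ℂ) * v (z - t)) := by
      rw [← integral_neg]
      refine setIntegral_congr_fun measurableSet_Ioi fun t (ht : 0 < t) ↦ ?_
      rw [h0, hv_ge (z + t) (by linarith)]; ring
    rw [hsum, harch]; ring
  -- integrability of the archimedean shifts
  have hIy := dt_integrableOn_archShift hvm hG₀ hL hvs hy.le
  have hIc := dt_integrableOn_archShift hvm hG₀ hL hvs le_rfl
  -- the difference
  have hdiff : T y - T c' = 2 * Pc * ((Real.cosh (y / 2) : ℂ) - (Real.cosh (c' / 2) : ℂ)) -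
      2 * Ps * ((Real.sinh (y / 2) : ℂ) - (Real.sinh (c' / 2) : ℂ)) -
      (∑ n ∈ I, (((ArithmeticFunction.vonMangoldt n : ℝ) / Real.sqrt n : ℝ) : ℂ) *
        (v (y - Real.log n) - v (c' - Real.log n))) +
      ∫ t in Ioi 0, (weilArchDensity t : ℂ) * (v (c' - t) - v (y - t)) := by
    rw [hTz y hy.le, hTz c' le_rfl]
    have e1 : (∫ t in Ioi 0, (weilArchDensity t : ℂ) * (v (c' - t) - v (y - t))) =
        (∫ t in Ioi 0, (weilArchDensity t : ℂ) * v (c' - t)) - ∫ t in Ioi 0, (weilArchDensity t : ℂ) * v (y - t) := by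
      rw [← integral_sub hIc hIy]
      refine integral_congr_ae (Eventually.of_forall fun t ↦ ?_); ring
    have e3 : (∑ n ∈ I, (((ArithmeticFunction.vonMangoldt n : ℝ) / Real.sqrt n : ℝ) : ℂ) *
        (v (y - Real.log n) - v (c' - Real.log n))) =
        (∑ n ∈ I, (((ArithmeticFunction.vonMangoldt n : ℝ) / Real.sqrt n : ℝ) : ℂ) * v (y - Real.log n)) -
        ∑ n ∈ I, (((ArithmeticFunction.vonMangoldt n : ℝ) / Real.sqrt n : ℝ) : ℂ) * v (c' - Real.log n) := by
      rw [← Finset.sum_sub_distrib]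
      exact Finset.sum_congr rfl fun n _ ↦ by ring
    rw [e1, e3]
    ring
  -- (1) pole layer
  have hpole : ‖2 * Pc * ((Real.cosh (y / 2) : ℂ) - (Real.cosh (c' / 2) : ℂ)) -
      2 * Ps * ((Real.sinh (y / 2) : ℂ) - (Real.sinh (c' / 2) : ℂ))‖ ≤ d * (12 * G₀) := by
    obtain ⟨hch, hsh⟩ := dt_cosh_sinh_half_sub_le hc'.le hy.le hy1
    have e5 : Real.exp (1 / 2) ≤ 5 / 3 := by
      have h1 : Real.exp (1 / 2) ^ 2 = Real.exp 1 := by rw [sq, ← Real.exp_add]; norm_num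
      nlinarith [Real.exp_pos (1 / 2), Real.exp_one_lt_d9]
    have hcosh' : Real.cosh (c' / 2) ≤ Real.exp (1 / 2) :=
      (dt_cosh_sinh_le_exp_half (by linarith) (by linarith)).1
    have hP : ‖Pc‖ ≤ 2 * c' * G₀ * Real.exp (1 / 2) :=
      hPcb.trans (mul_le_mul_of_nonneg_left hcosh' (by positivity))
    have hQ : ‖Ps‖ ≤ 2 * c' * G₀ * Real.exp (1 / 2) :=
      hPsb.trans (mul_le_mul_of_nonneg_left hcosh' (by positivity))
    have n1 : ‖((Real.cosh (y / 2) : ℂ) - (Real.cosh (c' / 2) : ℂ))‖ ≤ Real.exp (1 / 2) * (d / 2) := by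
      rw [← Complex.ofReal_sub, Complex.norm_real, Real.norm_eq_abs]; exact hch
    have n2 : ‖((Real.sinh (y / 2) : ℂ) - (Real.sinh (c' / 2) : ℂ))‖ ≤ Real.exp (1 / 2) * (d / 2) := by
      rw [← Complex.ofReal_sub, Complex.norm_real, Real.norm_eq_abs]; exact hsh
    calc ‖2 * Pc * ((Real.cosh (y / 2) : ℂ) - (Real.cosh (c' / 2) : ℂ)) -
          2 * Ps * ((Real.sinh (y / 2) : ℂ) - (Real.sinh (c' / 2) : ℂ))‖
        ≤ ‖2 * Pc * ((Real.cosh (y / 2) : ℂ) - (Real.cosh (c' / 2) : ℂ))‖ +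
          ‖2 * Ps * ((Real.sinh (y / 2) : ℂ) - (Real.sinh (c' / 2) : ℂ))‖ := norm_sub_le _ _
      _ = 2 * ‖Pc‖ * ‖((Real.cosh (y / 2) : ℂ) - (Real.cosh (c' / 2) : ℂ))‖ +
          2 * ‖Ps‖ * ‖((Real.sinh (y / 2) : ℂ) - (Real.sinh (c' / 2) : ℂ))‖ := by
          simp only [norm_mul, Complex.norm_ofNat]
      _ ≤ 2 * (2 * c' * G₀ * Real.exp (1 / 2)) * (Real.exp (1 / 2) * (d / 2)) +
          2 * (2 * c' * G₀ * Real.exp (1 / 2)) * (Real.exp (1 / 2) * (d / 2)) := by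
          gcongr
      _ = 4 * c' * G₀ * d * (Real.exp (1 / 2)) ^ 2 := by ring
      _ ≤ 4 * 1 * G₀ * d * (5 / 3) ^ 2 := by
          have : (Real.exp (1 / 2)) ^ 2 ≤ (5 / 3) ^ 2 := pow_le_pow_left₀ (Real.exp_pos _).le e5 2
          have h2 : 4 * c' * G₀ * d ≤ 4 * 1 * G₀ * d := by
            have : 0 ≤ G₀ * d := by positivity
            nlinarith
          calc 4 * c' * G₀ * d * Real.exp (1 / 2) ^ 2 ≤ 4 * c' * G₀ * d * (5 / 3) ^ 2 :=
                mul_le_mul_of_nonneg_left this (by positivity)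
            _ ≤ 4 * 1 * G₀ * d * (5 / 3) ^ 2 := mul_le_mul_of_nonneg_right h2 (by positivity)
      _ ≤ d * (12 * G₀) := by nlinarith
  -- (2) prime layer
  have hprime : ‖∑ n ∈ I, (((ArithmeticFunction.vonMangoldt n : ℝ) / Real.sqrt n : ℝ) : ℂ) *
      (v (y - Real.log n) - v (c' - Real.log n))‖ ≤ d * (Λs * L) := by
    calc ‖∑ n ∈ I, (((ArithmeticFunction.vonMangoldt n : ℝ) / Real.sqrt n : ℝ) : ℂ) *
          (v (y - Real.log n) - v (c' - Real.log n))‖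
        ≤ ∑ n ∈ I, ‖(((ArithmeticFunction.vonMangoldt n : ℝ) / Real.sqrt n : ℝ) : ℂ) *
          (v (y - Real.log n) - v (c' - Real.log n))‖ := norm_sum_le _ _
      _ ≤ ∑ n ∈ I, (ArithmeticFunction.vonMangoldt n : ℝ) / Real.sqrt n * (L * d) := by
          refine Finset.sum_le_sum fun n _ ↦ ?_
          rw [norm_mul, Complex.norm_real, Real.norm_of_nonneg (div_nonneg ArithmeticFunction.vonMangoldt_nonneg
            (Real.sqrt_nonneg _))]
          refine mul_le_mul_of_nonneg_left ?_ (div_nonneg ArithmeticFunction.vonMangoldt_nonneg (Real.sqrt_nonneg _))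
          have h := hL (y - Real.log n) (c' - Real.log n)
          rwa [show y - Real.log n - (c' - Real.log n) = d by rw [hd]; ring, abs_of_pos hd0] at h
      _ = d * (Λs * L) := by rw [hΛs, ← Finset.sum_mul]; ring
  -- (3) archimedean layer
  have harch : ‖∫ t in Ioi 0, (weilArchDensity t : ℂ) * (v (c' - t) - v (y - t))‖ ≤
      d * (L * (1 + C₁)) + d * (3 / 4 * L) * (-Real.log d) := by
    set H : ℝ → ℝ := fun t ↦ (Ioc 0 d).indicator (fun _ ↦ L) t +
      (Ioi d).indicator (fun t ↦ L * d * weilArchDensity t) t with hH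
    have hvol0 : volume (Ioc (0 : ℝ) d) ≠ ⊤ := by rw [Real.volume_Ioc]; exact ENNReal.ofReal_ne_top
    have i1 : IntegrableOn (fun t ↦ (Ioc 0 d).indicator (fun _ ↦ L) t) (Ioi (0 : ℝ)) :=
      ((integrableOn_const hvol0 (C := L)).integrable_indicator measurableSet_Ioc).integrableOn
    have iρ : IntegrableOn weilArchDensity (Ioi d) :=
      (dt_integrableOn_weilArchDensity_Ici hd0).mono_set Ioi_subset_Ici_self
    have iρ' : IntegrableOn (fun t ↦ L * d * weilArchDensity t) (Ioi d) := iρ.const_mul (L * d)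
    have i2 : IntegrableOn (fun t ↦ (Ioi d).indicator (fun t ↦ L * d * weilArchDensity t) t) (Ioi (0 : ℝ)) :=
      (iρ'.integrable_indicator measurableSet_Ioi).integrableOn
    have hHint : IntegrableOn H (Ioi 0) := i1.add i2
    have hdom : ∀ t ∈ Ioi (0 : ℝ), ‖(weilArchDensity t : ℂ) * (v (c' - t) - v (y - t))‖ ≤ H t := by
      intro t (ht : 0 < t)
      have hρ := (weilArchDensity_pos ht).le
      rw [norm_mul, Complex.norm_real, Real.norm_of_nonneg hρ]
      by_cases htd : t ≤ d
      · -- `v(y - t) = 0`, `‖v(c' - t)‖ ≤ L t`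
        have hzero : v (y - t) = 0 := hv_ge _ (by rw [hd] at htd; linarith)
        have hlip : ‖v (c' - t) - v (y - t)‖ ≤ L * t := by
          rw [hzero, sub_zero]
          have h := hL (c' - t) c'
          rw [hv_ge c' le_rfl, sub_zero, show c' - t - c' = -t by ring, abs_neg, abs_of_pos ht] at h
          exact h
        have h1 : weilArchDensity t * ‖v (c' - t) - v (y - t)‖ ≤ L := by
          calc weilArchDensity t * ‖v (c' - t) - v (y - t)‖ ≤ weilArchDensity t * (L * t) :=
                mul_le_mul_of_nonneg_left hlip hρ
            _ = (t * weilArchDensity t) * L := by ring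
            _ ≤ (1 / 2 + t / 4) * L := mul_le_mul_of_nonneg_right (mul_weilArchDensity_le ht) hL0
            _ ≤ 1 * L := by refine mul_le_mul_of_nonneg_right ?_ hL0; linarith [htd.trans hd1]
            _ = L := one_mul _
        have h2 : L ≤ H t := by
          rw [hH]; simp only [indicator_of_mem (show t ∈ Ioc (0 : ℝ) d from ⟨ht, htd⟩)]
          have : 0 ≤ (Ioi d).indicator (fun t ↦ L * d * weilArchDensity t) t := by
            by_cases h : t ∈ Ioi d
            · rw [indicator_of_mem h]; exact mul_nonneg (by positivity) hρ
            · rw [indicator_of_notMem h]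
          linarith
        exact h1.trans h2
      · have hlip : ‖v (c' - t) - v (y - t)‖ ≤ L * d := by
          have h := hL (c' - t) (y - t)
          rwa [show c' - t - (y - t) = -d by rw [hd]; ring, abs_neg, abs_of_pos hd0] at h
        have h1 : weilArchDensity t * ‖v (c' - t) - v (y - t)‖ ≤ L * d * weilArchDensity t := by
          rw [mul_comm]; exact mul_le_mul_of_nonneg_right hlip hρ
        have h2 : L * d * weilArchDensity t ≤ H t := by
          rw [hH]; simp only [indicator_of_mem (show t ∈ Ioi d from not_le.1 htd)]
          have : 0 ≤ (Ioc (0 : ℝ) d).indicator (fun _ ↦ L) t := by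
            by_cases h : t ∈ Ioc (0 : ℝ) d
            · rw [indicator_of_mem h]; exact hL0
            · rw [indicator_of_notMem h]
          linarith
        exact h1.trans h2
    have hle : ‖∫ t in Ioi 0, (weilArchDensity t : ℂ) * (v (c' - t) - v (y - t))‖ ≤ ∫ t in Ioi 0, H t :=
      norm_integral_le_of_norm_le hHint ((ae_restrict_iff' measurableSet_Ioi).2 (Eventually.of_forall hdom))
    have hHval : ∫ t in Ioi 0, H t = L * d + L * d * ∫ t in Ioi d, weilArchDensity t := by
      have e1 : ∫ t in Ioi (0 : ℝ), (Ioc (0 : ℝ) d).indicator (fun _ ↦ L) t = L * d := by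
        rw [integral_indicator measurableSet_Ioc, Measure.restrict_restrict measurableSet_Ioc,
          inter_eq_left.2 Ioc_subset_Ioi_self, setIntegral_const, Measure.real, Real.volume_Ioc, sub_zero,
          ENNReal.toReal_ofReal hd0.le, smul_eq_mul, mul_comm]
      have e2 : ∫ t in Ioi (0 : ℝ), (Ioi d).indicator (fun t ↦ L * d * weilArchDensity t) t =
          L * d * ∫ t in Ioi d, weilArchDensity t := by
        rw [integral_indicator measurableSet_Ioi, Measure.restrict_restrict measurableSet_Ioi,
          inter_eq_left.2 (Ioi_subset_Ioi hd0.le), integral_const_mul]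
      show ∫ t in Ioi (0 : ℝ), ((Ioc (0 : ℝ) d).indicator (fun _ ↦ L) t +
        (Ioi d).indicator (fun t ↦ L * d * weilArchDensity t) t) = _
      rw [integral_add i1 i2, e1, e2]
    have htail : ∫ t in Ioi d, weilArchDensity t ≤ 3 / 4 * (-Real.log d) + C₁ := by
      rw [setIntegral_congr_set (Ioi_ae_eq_Ici (μ := volume) (a := d))]
      have h := dt_setIntegral_weilArchDensity_Ici_le hd0
      have hmax : max 0 (-Real.log d) = -Real.log d :=
        max_eq_right (by have := Real.log_nonpos hd0.le hd1; linarith)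
      rw [hmax] at h
      exact h
    have hLd : 0 ≤ L * d := by positivity
    calc ‖∫ t in Ioi 0, (weilArchDensity t : ℂ) * (v (c' - t) - v (y - t))‖
        ≤ L * d + L * d * ∫ t in Ioi d, weilArchDensity t := by rw [← hHval]; exact hle
      _ ≤ L * d + L * d * (3 / 4 * (-Real.log d) + C₁) := by
          have := mul_le_mul_of_nonneg_left htail hLd; linarith
      _ = d * (L * (1 + C₁)) + d * (3 / 4 * L) * (-Real.log d) := by ring
  -- assemble
  rw [hdiff]
  calc ‖2 * Pc * ((Real.cosh (y / 2) : ℂ) - (Real.cosh (c' / 2) : ℂ)) -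
        2 * Ps * ((Real.sinh (y / 2) : ℂ) - (Real.sinh (c' / 2) : ℂ)) -
        (∑ n ∈ I, (((ArithmeticFunction.vonMangoldt n : ℝ) / Real.sqrt n : ℝ) : ℂ) *
          (v (y - Real.log n) - v (c' - Real.log n))) +
        ∫ t in Ioi 0, (weilArchDensity t : ℂ) * (v (c' - t) - v (y - t))‖
      ≤ ‖2 * Pc * ((Real.cosh (y / 2) : ℂ) - (Real.cosh (c' / 2) : ℂ)) -
          2 * Ps * ((Real.sinh (y / 2) : ℂ) - (Real.sinh (c' / 2) : ℂ))‖ +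
        ‖∑ n ∈ I, (((ArithmeticFunction.vonMangoldt n : ℝ) / Real.sqrt n : ℝ) : ℂ) *
          (v (y - Real.log n) - v (c' - Real.log n))‖ +
        ‖∫ t in Ioi 0, (weilArchDensity t : ℂ) * (v (c' - t) - v (y - t))‖ := by
          exact (norm_add_le _ _).trans (add_le_add (norm_sub_le _ _) le_rfl)
    _ ≤ d * (12 * G₀) + d * (Λs * L) + (d * (L * (1 + C₁)) + d * (3 / 4 * L) * (-Real.log d)) :=
          add_le_add (add_le_add hpole hprime) harch
    _ = d * (12 * G₀ + Λs * L + L * (1 + C₁)) + d * (3 / 4 * L) * (-Real.log d) := by ring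

end Summit.RiemannHypothesis.RiemannHypothesis.Theorems.EvenWinsBeyondArch

end
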